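import Literature.Geometry.Lorentzian.BlackHoles
import HarnessLib

/-!
# Barrier catalogue `FinalStateConjecture`: exponentially growing finite-energy Klein–Gordon modes on rotating Kerr (Shlapentokh-Rothman's superradiant instability)
(`Literature/Barriers/FinalStateConjecture/`, D-0021; family `gr`, summit `FinalStateConjecture`;
namespace `Literature.Barriers.FinalStateConjecture`)

This file vendors, as a **named fact** (D-0014), the theorem of Shlapentokh-Rothman that on
every sub-extremal Kerr exterior with `a ≠ 0` the Klein–Gordon equation `(□_g − μ²) ψ = 0`
admits, for an open family of masses `μ > 0`, smooth finite-energy solutions growing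
exponentially in time (Comm. Math. Phys. 329 (2014) 859–891, Thm. 1.1; precise mode form
Thm. 1.2) — "the first rigorous construction of a superradiant instability" (abstract) — together
with the author's printed consequence for the massless problem underlying Kerr stability:
"since [...] we have produced exponentially growing and finite energy solutions with arbitrarily
small mass [as `|a| → 0`] [...] any argument used for the wave equation must break down for
Klein–Gordon equations with arbitrarily small mass" (§1.1, p. 4).

* `Literature.Lorentz.sliceL2NormSq U ψ τ₀`, `Literature.Lorentz.kgSliceEnergy U ψ τ₀ μ` — the zeroth-order
  slice integral `∫ ψ²` and the coordinate Klein–Gordon energy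
  `sliceEnergy + μ² · sliceL2NormSq` through the leaves of the prelude foliation (companions of
  `sliceEnergy`, `WeightedNorms.lean`), with unfolding lemmas.
* `KleinGordonSuperradiantInstability` — **the barrier declaration** (structured block in its
  docstring); corollaries `.energy_unbounded`, `.no_uniform_energy_bound`.
* **Barrier audit 2026-08-15** (appended section): the ORDER OF QUANTIFIERS behind "arbitrarily
  small mass" — `kgSliceEnergy_ratio_unbounded_of_growth` (growth ⟹ unbounded energy ratios,
  isolated), `KleinGordonSuperradiantInstability.small_spin_small_mass` (from the fact: in every
  neighbourhood of `(a, μ) = (0, 0)` there are parameters with a growing finite-energy solution;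
  `m = 1`, `r₊ ≥ M`), the narrowed declaration `KleinGordonSuperradiantInstabilityNarrow` with the
  corrected block (certified: mass-robustness with an `a`-INDEPENDENT threshold for slowly rotating
  Kerr, and near-threshold / all-masses robustness at fixed `a`; NOT certified: fixed `a`, masses
  `μ ≪ |a|/M²` — heuristics predict growth, the cited lecture notes claim fixed-`m` boundedness),
  `KleinGordonSuperradiantInstabilityNarrow.of` (PROVED from the fact) and the explicit no-go
  `.no_small_parameter_bound` (no theorem "∀ 0 < a < a₀, ∀ 0 < μ < μ₀: E_KG(τ) ≤ C E_KG(0)").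

## Rendering on the prelude (conventions of `BlackHoles.lean`, gr.S24)

Notation: `t_KS` denotes the time coordinate (index `0`) of the prelude's ingoing Kerr–Schild
Cartesian chart (written `t*` in `KerrSchild.lean` and `WeightedNorms.lean`); SR's Kerr-star time
`t* = t + t̄(r)`, `dt̄/dr = (r² + a²)/Δ` (SR §1.2.1) is a different function — on `{r > r₊}` the
two differ by a smooth function of `r` alone (growing like `r` at infinity), both extend smoothly
across `𝓗⁺`, and both have coordinate vector field `∂_t = ∂_{t*} = ∂_{t_KS}`
(`Kerr.stationaryField`; SR §1.2.1: "`∂_t` in Boyer–Lindquist coordinates is equal to `∂_{t*}`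
in Kerr-star coordinates"). Below, slices are always the prelude leaves `{t_KS = τ} ∩ {r > r₊}`.

* *Carrier and equation.* Real functions `ψ` on the open Kerr–Schild exterior chart
  `Kerr.exterior M a = {r > r₊}` (model `𝓘(ℝ, E4)`), globally `C^∞`, solving
  `□_{g_{M,a}} ψ = μ² ψ` for the `C^∞` Kerr metric `Kerr.smoothMetric M a r₊`
  (`PseudoRiemannianMetric.dalembertian`, instance hypotheses `[Kerr.Facts] [Kerr.SliceFacts]`).
  The printed solutions are complex modes `e^{−iωt} e^{imφ} S_{ml}(θ) R(r)`, `Im ω = ε_μ > 0`, in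
  Boyer–Lindquist coordinates, which extend smoothly to the horizon in Kerr-star coordinates
  (Thm. 1.2, §2: `ψ = e^{−iωt*} e^{imφ*} S_{ml}(θ) f(r)` with `f` smooth up to `r₊`) and whose
  radial part `R` "is exponentially decaying at infinity" (§2, p. 8). In the prelude chart such a
  mode is `e^{−iω t_KS}` times a smooth function of `(r, θ, φ_KS)` on the closed exterior
  (the factor `e^{iω(t_KS − t*)}` has modulus `e^{−ε_μ (t_KS − t*)}`, bounded on `{r ≥ r₊ + 1}`
  up to a power of `r`, and is smooth up to `r₊`), and real and imaginary parts are real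
  solutions of the same equation.
* *Energy and growth.* SR's "finite energy" is the Klein–Gordon energy, which contains the
  zeroth-order term: `‖ψ(t)‖²_{Ḣ¹_x} + μ²‖ψ(t)‖²_{L²_x}` (§1.2.2), imposed on modes through
  `∫_{r₊+1}^∞ (|R|² + |dR/dr|²) r² dr < ∞` (§2, the finite-energy requirement, p. 7). It is
  rendered by the coordinate Klein–Gordon energy
  `kgSliceEnergy U ψ τ μ = sliceEnergy U ψ τ + μ² · sliceL2NormSq U ψ τ` of this file
  (`sliceEnergy` = `∫ Σ_ν (∂_ν ψ)²` over the leaf, `WeightedNorms.lean`, comparable to the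
  non-degenerate `J^N`-energy; `sliceL2NormSq` = `∫ ψ²` over the leaf), required to be FINITE on
  every leaf `{t_KS = τ}`, `τ ≥ 0`; exponential growth is rendered as
  `sliceEnergy ψ τ ≥ c e^{ε τ}` for all `τ ≥ 0`, some `c, ε > 0`. For (the real part of) a
  printed mode both hold: on `{t_KS = τ}` the mode and all its first partial derivatives are
  bounded near `𝓗⁺` (smooth extension) and exponentially decaying in `r` (bound state), so
  `kgSliceEnergy` is finite for every `τ`; and `ψ(t_KS, ·) = e^{ε_μ t_KS} Re(e^{−iω_R t_KS} Φ)`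
  gives `sliceEnergy ψ τ = e^{2ε_μ τ} Q(ω_R τ)` with `Q` a continuous, `2π`-periodic, strictly
  positive function (`Re(e^{−iθ}Φ)` is never locally constant, as `m ≠ 0`), whence
  `sliceEnergy ψ τ ≥ (min Q) e^{2ε_μ τ}` — consistent with the printed pointwise lower bound
  `e^{ε_μ t} |∂^α ψ(0, ·)| ≲ |∂^α ψ(t, ·)|`. Only this weaker, existence-form consequence is
  vendored, together with the printed **mass clause**: for every non-zero integer `m` and every
  `δ > 0` the mass can be taken with `|μ − |am|/(2Mr₊)| < δ` (Thm. 1.1: "For every non-zero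
  integer `m`, `μ` can be chosen arbitrarily close to `|am|/(2Mr₊)`. In particular, `μ` can be
  made arbitrarily small as `a → 0`"; Thm. 1.2 for the underlying one-parameter families of
  modes) — so that, with `m = 1`, the masses are arbitrarily small as `a → 0`, which is what the
  barrier block uses.

## References

* Y. Shlapentokh-Rothman, *Exponentially growing finite energy solutions for the Klein–Gordon
  equation on sub-extremal Kerr spacetimes*, Comm. Math. Phys. 329 (2014) 859–891
  (arXiv:1302.3448; Thm. 1.1 quoted from v3), abstract, Thm. 1.1 (p. 3), §1.1 (p. 4), §1.2.1–
  §1.2.2 (p. 4), Thms. 1.2–1.3 (p. 5), §2 (pp. 7–8) — page numbers of the held store copy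
  `paper:arxiv-1302.3448`.
* M. Dafermos, I. Rodnianski, Y. Shlapentokh-Rothman, Ann. of Math. 183 (2016) 787–913, §1.1.
* S. Klainerman, C. R. Mécanique 353 (2025), §2.5 (3) (p. 562).
* M. Dafermos, I. Rodnianski, *Lectures on black holes and linear waves*, arXiv:0811.0354, §4.1,
  §5.2 (the `J^N` energy and the Kerr foliation behind `sliceEnergy`); §8.3 (Open Problem 7 and
  the fixed-`m` remark; pp. 45–46 of the held store copy `paper:arxiv-0811.0354`).
* Barrier audit 2026-08-15: G. Moschidis, *Superradiant instabilities for short-range non-negative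
  potentials on Kerr spacetimes and applications*, J. Funct. Anal. 273 (2017) 2719–2813
  (arXiv:1608.02041), §1 (p. 3), §1.1 (Thm. 1), §1.2 (Thm. 2), §1.5; H. R. Beyer, *On the stability
  of the massive scalar field in Kerr space-time*, J. Math. Phys. 52 (2011) 102502
  (arXiv:1105.4956), §1 (p. 4); S. Detweiler, Phys. Rev. D 22 (1980) 2323–2326; T. Zouros,
  D. Eardley, Ann. Phys. 118 (1979) 139–155; S. Dolan, Phys. Rev. D 76 (2007) 084001
  (arXiv:0705.2880), §I and §IV; V. Georgescu, C. Gérard, D. Häfner, J. Eur. Math. Soc. 19 (2017)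
  (arXiv:1405.5304), Thm. 1.1; D. Häfner, C. R. Mécanique 353 (2025), §5.5.3;
  Y. Shlapentokh-Rothman, Ann. Henri Poincaré 16 (2015) 289–345 — page numbers of the held store
  copies `paper:arxiv-1608.02041`, `paper:arxiv-1105.4956`, `paper:arxiv-0705.2880`,
  `paper:arxiv-1405.5304`, `paper:doi-10-5802-crmeca-273`.
-/

noncomputable section

open Set MeasureTheory TopologicalSpace
open scoped Manifold ContDiff ENNReal

/-! ### The coordinate Klein–Gordon energy through the leaves `{t_KS = τ₀}` -/

namespace Literature.Barriers.FinalStateConjecture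

section KGEnergy

variable (U : Opens Literature.Geometry.Lorentzian.E4) (ψ : U → ℝ) (τ₀ : ℝ)

/-- The **slice `L²`-norm squared** of `ψ : U → ℝ` through the leaf `{t_KS = τ₀}`:
`∫_{y ∈ E3, (τ₀, y) ∈ U} ψ̃(τ₀, y)² dy ∈ [0, ∞]`, `ψ̃` the extension by zero of `ψ` (same
indicator and measure as `sliceEnergy`, `WeightedNorms.lean`) — the zeroth-order term of the
Klein–Gordon energy `‖ψ(t)‖²_{Ḣ¹_x} + μ²‖ψ(t)‖²_{L²_x}` (Shlapentokh-Rothman, CMP 329 (2014),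
§1.2.2; for modes, the term `∫ |R|² r² dr` of the finite-energy requirement of §2).
[cite: ShlapentokhRothman2014KleinGordon, §1.2.2 and §2] -/
def sliceL2NormSq : ℝ≥0∞ :=
  ∫⁻ y : Literature.Geometry.Lorentzian.E3, Set.indicator {y | Literature.Geometry.Lorentzian.E4.ofTimeSpace τ₀ y ∈ U}
    (fun y ↦ ENNReal.ofReal
      ((Function.extend Subtype.val ψ (0 : Literature.Geometry.Lorentzian.E4 → ℝ) (Literature.Geometry.Lorentzian.E4.ofTimeSpace τ₀ y)) ^ 2)) y

/-- The **coordinate Klein–Gordon energy** of `ψ : U → ℝ` with mass `μ` through the leaf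
`{t_KS = τ₀}`: `sliceEnergy U ψ τ₀ + μ² · sliceL2NormSq U ψ τ₀ ∈ [0, ∞]`, i.e.
`∫ (Σ_ν (∂_ν ψ̃)² + μ² ψ̃²)(τ₀, y) dy` — the coordinate rendering of
`‖ψ(t)‖²_{Ḣ¹_x} + μ²‖ψ(t)‖²_{L²_x}` (Shlapentokh-Rothman, CMP 329 (2014), §1.2.2: on Minkowski
space this quantity "is constant in time"). [cite: ShlapentokhRothman2014KleinGordon, §1.2.2] -/
def kgSliceEnergy (μ : ℝ) : ℝ≥0∞ :=
  Literature.Geometry.Lorentzian.sliceEnergy U ψ τ₀ + ENNReal.ofReal (μ ^ 2) * sliceL2NormSq U ψ τ₀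

/-- The first-order energy is dominated by the Klein–Gordon energy. SR, CMP 329 (2014), §1.2.2.
[cite: ShlapentokhRothman2014KleinGordon, §1.2.2] -/
theorem sliceEnergy_le_kgSliceEnergy (μ : ℝ) : Literature.Geometry.Lorentzian.sliceEnergy U ψ τ₀ ≤ kgSliceEnergy U ψ τ₀ μ :=
  le_self_add

/-- For mass `μ = 0` the Klein–Gordon energy is the slice energy of `WeightedNorms.lean`.
SR, CMP 329 (2014), §1.2.2. [cite: ShlapentokhRothman2014KleinGordon, §1.2.2] -/
@[simp]
theorem kgSliceEnergy_zero_mass : kgSliceEnergy U ψ τ₀ 0 = Literature.Geometry.Lorentzian.sliceEnergy U ψ τ₀ := by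
  simp [kgSliceEnergy]

/-- For `μ ≠ 0`, finiteness of the Klein–Gordon energy is finiteness of BOTH the first-order
energy and the slice `L²`-norm (the two terms of SR's finite-energy requirement,
`∫ (|R|² + |dR/dr|²) r² dr < ∞`). SR, CMP 329 (2014), §2.
[cite: ShlapentokhRothman2014KleinGordon, §2] -/
theorem kgSliceEnergy_lt_top_iff {μ : ℝ} (hμ : μ ≠ 0) :
    kgSliceEnergy U ψ τ₀ μ < ⊤ ↔ Literature.Geometry.Lorentzian.sliceEnergy U ψ τ₀ < ⊤ ∧ sliceL2NormSq U ψ τ₀ < ⊤ := by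
  have h : ENNReal.ofReal (μ ^ 2) ≠ 0 := by
    rw [Ne, ENNReal.ofReal_eq_zero, not_le]
    positivity
  rw [kgSliceEnergy, ENNReal.add_lt_top, ENNReal.mul_lt_top_iff]
  simp only [ENNReal.ofReal_lt_top, true_and, h, false_or]
  constructor
  · rintro ⟨h1, h2 | h2⟩
    · exact ⟨h1, h2⟩
    · exact ⟨h1, by rw [h2]; exact ENNReal.zero_lt_top⟩
  · rintro ⟨h1, h2⟩
    exact ⟨h1, Or.inl h2⟩

end KGEnergy

end Literature.Barriers.FinalStateConjecture

namespace Literature.Barriers.FinalStateConjecture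

open Literature.Geometry.Lorentzian

/-- **Barrier (superradiant instability of massive fields): on every sub-extremal Kerr exterior
with `a ≠ 0` there are masses `μ > 0` for which the Klein–Gordon equation has smooth,
finite-energy, exponentially growing solutions.** Shlapentokh-Rothman, Comm. Math. Phys. 329
(2014), Thm. 1.1, as printed in the final arXiv version arXiv:1302.3448v3 (2014): "Fix a Kerr
spacetime `(𝓜, g_{a,M})` with `M > 0` and `0 < |a| < M`. Then there exists an open family of
masses `μ` with `ε_μ > 0` and a non-zero, smooth, and finite energy solution `ψ` to the
corresponding Klein–Gordon equation `(□_g − μ²)ψ = 0` such that for every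
`(t, r, θ, φ) ∈ ℝ × (M + √(M² − a²), ∞) × 𝕊²`,
`e^{ε_μ t} |∂^α ψ(0, r, θ, φ)| ≲_α |∂^α ψ(t, r, θ, φ)|` for all multi-indices `α`." "These
statements should be understood with respect to Boyer–Lindquist coordinates. For every non-zero
integer `m`, `μ` can be chosen arbitrarily close to `|am|/(2Mr₊)`. In particular, `μ` can be
made arbitrarily small as `a → 0`." (The earlier arXiv version held in the literature store,
`paper:arxiv-1302.3448`, prints the hypothesis of Thm. 1.1 as "with `a ≠ 0` (see section
[1.2.1])", its §1.2.1 fixing "some non-zero mass `M`" and assuming "that we are sub-extremal,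
i.e. `|a| < M`" — the same hypotheses.) The hypotheses `M > 0`, `0 < |a| < M` are rendered below
as `Kerr.IsSubextremal M a` (`|a| < M`, whence `M > 0`) and `a ≠ 0`; "finite energy" is the
Klein–Gordon energy `‖ψ‖²_{Ḣ¹} + μ²‖ψ‖²_{L²}` of §1.2.2 (for modes: `∫ (|R|² + |R'|²) r² dr < ∞`,
§2), rendered by `kgSliceEnergy` (module docstring).

**Vendored form** (existence form with the printed mass clause; module docstring): for
`0 < |a| < M`, every non-zero integer `m` and every `δ > 0` there are a mass `μ > 0` with
`|μ − |am|/(2Mr₊)| < δ`, rates `ε > 0`, `c > 0` and a globally `C^∞` real `ψ` on the exterior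
chart `Kerr.exterior M a` with `□_{g_{M,a}} ψ = μ² ψ`, FINITE coordinate Klein–Gordon energy
`kgSliceEnergy ψ τ μ < ∞` through every leaf `{t_KS = τ}`, `τ ≥ 0`, and
`sliceEnergy ψ τ ≥ c e^{ε τ}` for all `τ ≥ 0`.

BARRIER (D-0021; every clause is a quotation or close paraphrase of the cited locus):
* technique_class: kerr-stability, energy-estimates, vectorfield-method, mass-insensitive, lower-order-robust, Klein-Gordon, general-linear-fields, boundedness-by-structure, small-angular-momentum
* blocks: any boundedness or decay argument for the wave equation on Kerr `a ≠ 0` (hence any linear step of a Kerr stability proof feeding clause (ii) of the final state conjecture, `Literature.Geometry.Lorentzian.Development.SettlesToKerrFamily`) that would apply verbatim to `(□_g − μ²)ψ = 0` for arbitrarily small `μ > 0` — "any argument used for the wave equation must break down for Klein–Gordon equations with arbitrarily small mass" [cite: ShlapentokhRothman2014KleinGordon, §1.1 (p. 4)]; in particular a uniform energy-boundedness statement of the shape of `Literature.Geometry.Lorentzian.drsr_wave_boundedness_kerr` (`E(τ) ≤ C · E(0)`) for the Klein–Gordon energy with such masses (`KleinGordonSuperradiantInstability.no_uniform_energy_bound`),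 arguments insensitive to zeroth-order terms in the superradiant bounded-frequency regime, where "new obstructions to boundedness, not just decay, arise" (ibid.), and unconditional linear stability of Kerr as a solution of the Einstein–Klein–Gordon system for such masses [cite: ShlapentokhRothman2014KleinGordon, abstract].
* because: the growing solutions are "superradiant bound states, i.e. the energy flux will be negative along the horizon, and the solution will spatially decay exponentially fast so that no energy is radiated away to infinity. For such solutions the energy coming out of the black hole cannot escape; this is what provides the mechanism for the exponential growth" [cite: ShlapentokhRothman2014KleinGordon, §1 (p. 4)]; they are modes `e^{−iωt}e^{imφ}S(θ)R(r)` with `Im ω > 0`, obtained by perturbing real modes with `am − 2Mr₊ω = 0` into the upper half-plane, necessarily superradiant, `|am| − 2Mr₊|ω| > 0` [cite: ShlapentokhRothman2014KleinGordon, Thms. 1.2–1.3 (p. 5)]; the horizon energy density of `T` for `a ≠ 0` "is clearly possible [...] to be negative", i.e. the failure of `T` to be timelike (`KerrSuperradiance.lean`) [cite: ShlapentokhRothman2014KleinGordon, §1 (pp. 3–4)] [cite: Klainerman2025, §2.5 (3)].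
* evasions_known: for the massless wave equation on the full sub-extremal range boundedness and decay do hold (vendored `Literature.Geometry.Lorentzian.drsr_wave_boundedness_kerr`, `drsr_wave_polynomial_decay_kerr`), the proof using quantitative mode stability on the real axis — absence of real-frequency resonances, which is exactly what fails here through the real modes of Thm. 1.3 — and the structure "superradiant frequencies are not trapped" [cite: DafermosRodnianskiShlapentokhrothman2014, §1.1 and Thm. 3.1] [cite: Whiting1989] [cite: Shlapentokhrothman2014]; the printed growing modes are perturbations of real bound-state modes, and real bound-state modes (`ω ∈ ℝ`, `μ² > ω²`) exist only with `am − 2Mr₊ω = 0` and `am ≠ 0` [cite: ShlapentokhRothman2014KleinGordon, Thm. 1.3]. None of the cited sources records a mass-robust decay mechanism.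
* scope_caveats: (a) the theorem concerns the MASSIVE equation `(□_g − μ²)ψ = 0` for particular masses `μ > 0` — here: some `μ` in every neighbourhood of each `|am|/(2Mr₊)`, `m ∈ ℤ ∖ {0}` (printed: an open family of such masses; openness is not vendored), so for FIXED `a ≠ 0` the certified masses are bounded below near `|a|/(2Mr₊)` and become small only as `a → 0` — nothing is asserted about the massless equation or the vacuum equations, for which boundedness and decay do hold on the full sub-extremal range (`evasions_known`); as a barrier it constrains only techniques indifferent to the zeroth-order term; (b) existence form: one real solution with finite coordinate Klein–Gordon energy (`∫ |∂ψ|² + μ²ψ²`) on every leaf `{t_KS = τ}`, `τ ≥ 0`, of the prelude's Kerr–Schild foliation and a lower exponential bound on its first-order coordinate energy there — the printed pointwise bounds for all derivatives in Boyer–Lindquist coordinates, the mode structure and the smooth extension to `𝓗⁺` are not vendored; (c) `0 < |a| < M` only (as printed); the leaves `{t_KS = τ}` of the prelude chart are neither SR's Kerr-star slices `{t* = τ}` nor Boyer–Lindquist slices (the three time functions differ by functions of `r`), and the finiteness and growth of the coordinate energies of the printed modes on these leaves are argued in the module docstring (smoothness at `𝓗⁺`, exponential decay of `R`, `∂_t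 = ∂_{t_KS}`), not proved; (d) the sources do not claim any nonlinear (Einstein–Klein–Gordon) instability, only "direct relevance" [cite: ShlapentokhRothman2014KleinGordon, abstract]; (e) NARROWED by the barrier audit of 2026-08-15 — see `KleinGordonSuperradiantInstabilityNarrow` below: the clause "for arbitrarily small `μ > 0`" of `blocks:` and the tags `mass-insensitive`, `lower-order-robust`, `general-linear-fields` of `technique_class:` are certified by the theorem only (i) uniformly over slowly rotating Kerr — schemes stated for all `|a| < a₀` and robust under masses below an `a`-INDEPENDENT threshold (`.small_spin_small_mass`, `.no_small_parameter_bound`; the premise "as `|a| → 0`" of the quoted sentence [cite: ShlapentokhRothman2014KleinGordon, §1.1 (p. 4)]) — and (ii) at fixed `a ≠ 0` for masses in a neighbourhood of `|am|/(2Mr₊)`, `m ≠ 0` (hence for schemes indifferent to ALL masses); for fixed `a` and masses `μ ≪ |a|/M²` no theorem in the sources applies (growth is predicted heuristically [cite: Detweiler1980] [cite: Dolan2007, §IV], fixed-`m` boundedness is claimed [cite: arXiv08110354, §8.3]), so the last sentence of `evasions_known:` is inaccurate as a matter of record — the cited lecture notes DO record a claimed mass-robust (fixed-`m`, small-`a`,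 small-`μ`) boundedness mechanism, whose literal form the mode families of Thm. 1.2 refute and whose weakened form "`μ` small relative to `a` and `m`" [cite: ShlapentokhRothman2014KleinGordon, §1.4 (p. 5)] is unproved; (f) `lower-order-robust` at fixed `a` is certified for LARGE short-range non-negative potentials [cite: Moschidis2017, Thm. 1] and not for small ones, under which real-mode stability persists [cite: Moschidis2017, §1 (p. 3)].
* status: established — theorem [cite: ShlapentokhRothman2014KleinGordon, Thm. 1.1]. -/
def KleinGordonSuperradiantInstability : Prop :=
  ∀ [Kerr.Facts] [Kerr.SliceFacts] (M a : ℝ), Kerr.IsSubextremal M a → a ≠ 0 →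
    ∀ m : ℤ, m ≠ 0 → ∀ δ > (0 : ℝ),
    ∃ μ > (0 : ℝ), |μ - |a * m| / (2 * M * Kerr.rPlus M a)| < δ ∧
    ∃ ε > (0 : ℝ), ∃ c > (0 : ℝ), ∃ ψ : Kerr.exterior M a → ℝ,
      ContMDiff 𝓘(ℝ, E4) 𝓘(ℝ, ℝ) ∞ ψ ∧
      (∀ x : Kerr.exterior M a,
        (Kerr.smoothMetric M a (Kerr.rPlus M a)).toPseudoRiemannianMetric.dalembertian ψ x =
          μ ^ 2 * ψ x) ∧
      (∀ τ : ℝ, 0 ≤ τ → kgSliceEnergy (Kerr.exterior M a) ψ τ μ < ⊤) ∧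
      ∀ τ : ℝ, 0 ≤ τ →
        ENNReal.ofReal (c * Real.exp (ε * τ)) ≤ sliceEnergy (Kerr.exterior M a) ψ τ

/-- Under the fact, the first-order coordinate energy of the witnessing Klein–Gordon solution —
whose Klein–Gordon energy is finite on every leaf `{t_KS = τ}`, `τ ≥ 0` — is unbounded in time:
for every `B < ∞` some `τ ≥ 0` has `sliceEnergy ψ τ > B` (from `c e^{ε τ} → ∞`).
Shlapentokh-Rothman, CMP 329 (2014), Thm. 1.1 and §1.1.
[cite: ShlapentokhRothman2014KleinGordon, Thm. 1.1] -/
theorem KleinGordonSuperradiantInstability.energy_unbounded (h : KleinGordonSuperradiantInstability)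
    [Kerr.Facts] [Kerr.SliceFacts] {M a : ℝ} (hMa : Kerr.IsSubextremal M a) (ha : a ≠ 0) :
    ∃ (μ : ℝ) (ψ : Kerr.exterior M a → ℝ), 0 < μ ∧ ContMDiff 𝓘(ℝ, E4) 𝓘(ℝ, ℝ) ∞ ψ ∧
      (∀ x : Kerr.exterior M a,
        (Kerr.smoothMetric M a (Kerr.rPlus M a)).toPseudoRiemannianMetric.dalembertian ψ x =
          μ ^ 2 * ψ x) ∧
      (∀ τ : ℝ, 0 ≤ τ → kgSliceEnergy (Kerr.exterior M a) ψ τ μ < ⊤) ∧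
      ∀ B : ℝ, ∃ τ : ℝ, 0 ≤ τ ∧ ENNReal.ofReal B < sliceEnergy (Kerr.exterior M a) ψ τ := by
  obtain ⟨μ, hμ, -, ε, hε, c, hc, ψ, hψ, hsol, hfin, hgrow⟩ := h M a hMa ha 1 one_ne_zero 1 one_pos
  refine ⟨μ, ψ, hμ, hψ, hsol, hfin, fun B ↦ ?_⟩
  obtain ⟨τ, hτ⟩ : ∃ τ : ℝ, 0 ≤ τ ∧ B < c * Real.exp (ε * τ) := by
    obtain ⟨n, hn⟩ := (Real.tendsto_exp_atTop.comp
      (Filter.tendsto_id.const_mul_atTop hε)).eventually_gt_atTop (B / c) |>.exists_forall_of_atTop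
    refine ⟨max n 0, le_max_right _ _, ?_⟩
    have := hn (max n 0) (le_max_left _ _)
    simp only [Function.comp_apply, id_eq] at this
    rwa [div_lt_iff₀ hc, mul_comm] at this
  exact ⟨τ, hτ.1, (ENNReal.ofReal_lt_ofReal_iff (by positivity)).2 hτ.2 |>.trans_le (hgrow τ hτ.1)⟩

/-- Under the fact, **no uniform energy-boundedness statement of the shape of
`Literature.Geometry.Lorentzian.drsr_wave_boundedness_kerr` holds for the Klein–Gordon energy with the witnessing mass**:
for the witnessing solution `ψ` (finite Klein–Gordon energy on all leaves `τ ≥ 0`) and every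
constant `C < ∞` there is `τ ≥ 0` with `kgSliceEnergy ψ τ μ > C · kgSliceEnergy ψ 0 μ` —
"new obstructions to boundedness, not just decay, arise in the superradiant bounded-frequency
regime". Shlapentokh-Rothman, CMP 329 (2014), Thm. 1.1 and §1.1 (p. 4).
[cite: ShlapentokhRothman2014KleinGordon, Thm. 1.1 and §1.1] -/
theorem KleinGordonSuperradiantInstability.no_uniform_energy_bound
    (h : KleinGordonSuperradiantInstability) [Kerr.Facts] [Kerr.SliceFacts] {M a : ℝ}
    (hMa : Kerr.IsSubextremal M a) (ha : a ≠ 0) :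
    ∃ (μ : ℝ) (ψ : Kerr.exterior M a → ℝ), 0 < μ ∧ ContMDiff 𝓘(ℝ, E4) 𝓘(ℝ, ℝ) ∞ ψ ∧
      (∀ x : Kerr.exterior M a,
        (Kerr.smoothMetric M a (Kerr.rPlus M a)).toPseudoRiemannianMetric.dalembertian ψ x =
          μ ^ 2 * ψ x) ∧
      (∀ τ : ℝ, 0 ≤ τ → kgSliceEnergy (Kerr.exterior M a) ψ τ μ < ⊤) ∧
      ∀ C : ℝ≥0∞, C ≠ ⊤ → ∃ τ : ℝ, 0 ≤ τ ∧
        C * kgSliceEnergy (Kerr.exterior M a) ψ 0 μ < kgSliceEnergy (Kerr.exterior M a) ψ τ μ := by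
  obtain ⟨μ, ψ, hμ, hψ, hsol, hfin, hunb⟩ := h.energy_unbounded hMa ha
  refine ⟨μ, ψ, hμ, hψ, hsol, hfin, fun C hC ↦ ?_⟩
  have h0 : C * kgSliceEnergy (Kerr.exterior M a) ψ 0 μ ≠ ⊤ :=
    ENNReal.mul_ne_top hC (hfin 0 le_rfl).ne
  obtain ⟨τ, hτ, hB⟩ := hunb (C * kgSliceEnergy (Kerr.exterior M a) ψ 0 μ).toReal
  refine ⟨τ, hτ, ?_⟩
  rw [ENNReal.ofReal_toReal h0] at hB
  exact hB.trans_le (sliceEnergy_le_kgSliceEnergy _ _ _ _)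

/-! ### Barrier audit 2026-08-15 (D-0021): quantifier order — an arbitrarily small mass is certified only together with an arbitrarily small spin

The block of `KleinGordonSuperradiantInstability` above blocks "any boundedness or decay argument
for the wave equation on Kerr `a ≠ 0` [...] that would apply verbatim to `(□_g − μ²)ψ = 0` for
arbitrarily small `μ > 0`" and tags the class `mass-insensitive, lower-order-robust`. The audit
narrows this to what the vendored theorem certifies, by making the ORDER OF QUANTIFIERS explicit.

(1) *What is certified.* At FIXED `0 < |a| < M` the theorem gives growing finite-energy solutions
only for masses in a `δ`-neighbourhood of `|am|/(2Mr₊)`, `m ∈ ℤ ∖ {0}` — the printed families are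
`(ω_R(ε) + iε, m, l, μ(ε))`, `|ε| < δ`, with `μ(0) > |ω_R(0)| = |am|/(2Mr₊)` and
`∂μ/∂ε(0) < 0` (SR, Thm. 1.2, p. 5), and real bound-state modes exist only at
`ω = am/(2Mr₊)`, `am ≠ 0`, `ω² < μ² < ω² + C(m, l)` (Thm. 1.3, p. 5); the smallest certified
mass at fixed `a` is thus `≈ |a|/(2Mr₊) ≥ |a|/(4M²)`. "Arbitrarily small mass" is reached only
along `|a| → 0` (Thm. 1.1: "In particular, `μ` can be made arbitrarily small as `a → 0`", p. 3;
§1.1: "as `|a| → 0` [...] we have produced exponentially growing and finite energy solutions with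
arbitrarily small mass. Thus, any argument used for the wave equation must break down for
Klein–Gordon equations with arbitrarily small mass", p. 4). Formally:
`KleinGordonSuperradiantInstability.small_spin_small_mass` — in every neighbourhood of
`(a, μ) = (0, 0)` there are parameters carrying a growing finite-energy solution (with `m = 1`,
using `r₊ ≥ M`, `|a|/(2Mr₊) ≤ |a|/(2M²)`) — packaged as the narrowed declaration
`KleinGordonSuperradiantInstabilityNarrow` (implied by the fact, `.of`), whose corollary
`.no_small_parameter_bound` is the honest blocking content: there is NO theorem of the shape
"`∃ a₀, μ₀ > 0` such that for all `0 < a < a₀` and all `0 < μ < μ₀` the finite-energy solutions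
of `□_g ψ = μ²ψ` on Kerr `(M, a)` have `E_KG(τ) ≤ C · E_KG(0)`" — i.e. what must "break down" is
an argument for slowly rotating Kerr whose mass-robustness threshold is INDEPENDENT of `a`.

(2) *What is not certified (gap).* For fixed `a ≠ 0` and masses `μ ≪ |a|/M²` (the "Detweiler
regime" `Mμ ≪ 1`, `μ < mΩ_H`, `Ω_H = a/(2Mr₊)`) no theorem in the sources produces a growing
solution, and none excludes one. The heuristic and numerical literature predicts growth for EVERY
`0 < μ < mΩ_H`: an e-folding time "`τ ≈ 24 (a/M)⁻¹ (μM)⁻⁹ (GM/c³)`" for `l = m = 1`, `Mμ ≪ 1`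
(Detweiler 1980, as quoted by Dolan, PRD 76 (2007) 084001, §I), "all bound states with
`Re(ω) ≲ ω_c` are unstable" (Dolan 2007, §IV; `ω_c = mΩ_H`); SR §1.5 (p. 6): "Zouros and Eardley
and Detweiler developed more involved heuristics, all leading to the same conclusion"; DR,
arXiv:0811.0354, §8.3: "it is thought that essentially this sequence 'moves up' and produces
exponentially growing solutions". AGAINST this, the cited lecture notes record a claimed
mass-robust mechanism at fixed azimuthal number — contrary to the last sentence of the original
`evasions_known:` — "if one fixed `m`, then adapting the proof of Section [5.2], one can show that
for `μ > 0` sufficiently small and `a` sufficiently small, depending on `m`, the statement of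
Theorem [5.1] holds for [`□_g ψ = μψ`] for such Kerr's" (DR, arXiv:0811.0354, §8.3, after Open
Problem 7; bracketed numbers resolve the labels of the arXiv version: the boundedness theorem for
metrics close to Schwarzschild and its proof), re-reported as "if `a` is small, and `μ` is small relative to `a` and `m`, then the
techniques developed by Dafermos and Rodnianski [Invent. Math. 185 (2011)] can be used to show
that no unstable modes exist" (SR §1.4, p. 5). In its literal form (`μ < μ₀(m)`, `|a| < a₀(m)`)
the lecture-notes claim is incompatible with Thm. 1.2 at the same `m` (take `|a|` small, so that
`|am|/(2Mr₊) < μ₀(m)`); in the weakened form ("`μ` small relative to `a`") it is asserted without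
proof and contradicts the heuristic rate above. Either resolution — fixed-`m` boundedness for
`μ ≪ |a|`, or growing modes throughout `0 < μ < mΩ_H` — is open in these sources (Häfner's 2025
survey still cites Thm. 1.1 as the result on record: "the presence of mass or charge of the field
can also create growing modes, we refer to Shlapentokh-Rothman for the Klein Gordon equation on the
Kerr metric", C. R. Mécanique 353 (2025), §5.5.3). Rigorous statements ADJACENT to the gap:
fixed-`m` stability for LARGE masses, "the solutions of the RKG are stable for
`μ ≥ (|m|a/(2Mr₊)) √(1 + 2M/r₊)`" (Beyer, J. Math. Phys. 52 (2011) 102502, §1); on De Sitter–Kerr,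
"There exists `a₀ > 0` such that for all `|a| < a₀` and `n ∈ ℤ ∖ {0}`" asymptotic completeness of
the Klein–Gordon field (mass `m ≥ 0`; `m > 0` needed at `n = 0`) at azimuthal number `n`
(Georgescu–Gérard–Häfner, JEMS 19 (2017), arXiv:1405.5304, Thm. 1.1);
at fixed `a`, LARGE short-range non-negative potentials do produce growing modes for `□_g ψ − Vψ = 0`
("For any `0 < |a| < M`, any `ω_R ∈ ℝ ∖ {0}`, any `r₀ ≫ 1` [...] and any `0 ≤ ω_I ≪ 1` [...] there
exists a `V : 𝓜_{M,a} → [0, +∞)` compactly supported in the region `{r ≥ r₀}` [...] such that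
[`□_g ψ − Vψ = 0`] admits an outgoing mode solution with frequency parameter `ω_R + iω_I`",
Moschidis, JFA 273 (2017), Thm. 1) while SMALL ones do not disturb mode stability ("the techniques
employed in [SR, AHP 16 (2015)] are robust enough to yield a mode stability statement for small
short-range potential perturbations", ibid., §1, p. 3).

`KleinGordonSuperradiantInstabilityNarrow` carries the corrected block; every clause there is a
quotation with locator. Nothing new is assumed: the narrowed declaration follows from the original
fact (`KleinGordonSuperradiantInstabilityNarrow.of`). -/

/-- **Exponential growth of the first-order energy forces unbounded Klein–Gordon energy ratios.**
If the coordinate Klein–Gordon energy of `ψ` (mass `μ`) is finite on all leaves `{t_KS = τ}`,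
`τ ≥ 0`, and `sliceEnergy ψ τ ≥ c e^{ετ}` there (`c, ε > 0`), then for every `C < ∞` some
`τ ≥ 0` has `kgSliceEnergy ψ τ μ > C · kgSliceEnergy ψ 0 μ` (the step "Thm. 1.1 ⟹ no uniform
energy bound" of `KleinGordonSuperradiantInstability.no_uniform_energy_bound`, isolated for reuse).
Shlapentokh-Rothman, CMP 329 (2014), §1.1 (p. 4): "new obstructions to boundedness, not just
decay, arise". [cite: ShlapentokhRothman2014KleinGordon, §1.1 (p. 4)] -/
theorem kgSliceEnergy_ratio_unbounded_of_growth {U : Opens E4} {ψ : U → ℝ} {μ ε c : ℝ}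
    (hε : 0 < ε) (hc : 0 < c)
    (hfin : ∀ τ : ℝ, 0 ≤ τ → kgSliceEnergy U ψ τ μ < ⊤)
    (hgrow : ∀ τ : ℝ, 0 ≤ τ → ENNReal.ofReal (c * Real.exp (ε * τ)) ≤ sliceEnergy U ψ τ)
    (C : ℝ≥0∞) (hC : C ≠ ⊤) :
    ∃ τ : ℝ, 0 ≤ τ ∧ C * kgSliceEnergy U ψ 0 μ < kgSliceEnergy U ψ τ μ := by
  have h0 : C * kgSliceEnergy U ψ 0 μ ≠ ⊤ := ENNReal.mul_ne_top hC (hfin 0 le_rfl).ne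
  obtain ⟨τ, hτ, hBτ⟩ : ∃ τ : ℝ, 0 ≤ τ ∧
      (C * kgSliceEnergy U ψ 0 μ).toReal < c * Real.exp (ε * τ) := by
    obtain ⟨n, hn⟩ := (Real.tendsto_exp_atTop.comp
      (Filter.tendsto_id.const_mul_atTop hε)).eventually_gt_atTop
        ((C * kgSliceEnergy U ψ 0 μ).toReal / c) |>.exists_forall_of_atTop
    refine ⟨max n 0, le_max_right _ _, ?_⟩
    have := hn (max n 0) (le_max_left _ _)
    simp only [Function.comp_apply, id_eq] at this
    rw [div_lt_iff₀ hc] at this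
    exact this.trans_eq (mul_comm _ _)
  refine ⟨τ, hτ, ?_⟩
  calc C * kgSliceEnergy U ψ 0 μ = ENNReal.ofReal (C * kgSliceEnergy U ψ 0 μ).toReal :=
        (ENNReal.ofReal_toReal h0).symm
    _ < ENNReal.ofReal (c * Real.exp (ε * τ)) :=
        (ENNReal.ofReal_lt_ofReal_iff (by positivity)).2 hBτ
    _ ≤ sliceEnergy U ψ τ := hgrow τ hτ
    _ ≤ kgSliceEnergy U ψ τ μ := sliceEnergy_le_kgSliceEnergy _ _ _ _

/-- **Small spin AND small mass — the certified reading of "arbitrarily small mass as `a → 0`".**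
Under the fact, for every `M > 0` and all thresholds `a₀, μ₀ > 0` there are a spin
`0 < a < a₀` with `a < M` (sub-extremal), a mass `0 < μ < μ₀` and a globally `C^∞` real solution
of `□_{g_{M,a}} ψ = μ² ψ` on `Kerr.exterior M a` with finite coordinate Klein–Gordon energy on
every leaf `{t_KS = τ}`, `τ ≥ 0`, and `sliceEnergy ψ τ ≥ c e^{ε τ}` (`c, ε > 0`). Proof: the mass
clause with `m = 1`, `δ = μ₀/2` at spin `a = min(a₀/2, M/2, M²μ₀)`, where `r₊ ≥ M` gives
`|a|/(2Mr₊) ≤ a/(2M²) ≤ μ₀/2`. This — joint smallness, the mass threshold NOT depending on the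
spin — is exactly the premise of "as `|a| → 0` [...] we have produced exponentially growing and
finite energy solutions with arbitrarily small mass. Thus, any argument used for the wave equation
must break down for Klein–Gordon equations with arbitrarily small mass"; at fixed `a` the theorem
certifies only masses near `|am|/(2Mr₊)`. Shlapentokh-Rothman, CMP 329 (2014), Thm. 1.1 (p. 3)
and §1.1 (p. 4). [cite: ShlapentokhRothman2014KleinGordon, Thm. 1.1 (p. 3) and §1.1 (p. 4)] -/
theorem KleinGordonSuperradiantInstability.small_spin_small_mass
    (h : KleinGordonSuperradiantInstability) [Kerr.Facts] [Kerr.SliceFacts] {M a₀ μ₀ : ℝ}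
    (hM : 0 < M) (ha₀ : 0 < a₀) (hμ₀ : 0 < μ₀) :
    ∃ a : ℝ, 0 < a ∧ a < a₀ ∧ Kerr.IsSubextremal M a ∧
    ∃ μ : ℝ, 0 < μ ∧ μ < μ₀ ∧
    ∃ ε > (0 : ℝ), ∃ c > (0 : ℝ), ∃ ψ : Kerr.exterior M a → ℝ,
      ContMDiff 𝓘(ℝ, E4) 𝓘(ℝ, ℝ) ∞ ψ ∧
      (∀ x : Kerr.exterior M a,
        (Kerr.smoothMetric M a (Kerr.rPlus M a)).toPseudoRiemannianMetric.dalembertian ψ x =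
          μ ^ 2 * ψ x) ∧
      (∀ τ : ℝ, 0 ≤ τ → kgSliceEnergy (Kerr.exterior M a) ψ τ μ < ⊤) ∧
      ∀ τ : ℝ, 0 ≤ τ →
        ENNReal.ofReal (c * Real.exp (ε * τ)) ≤ sliceEnergy (Kerr.exterior M a) ψ τ := by
  obtain ⟨a, ha_pos, ha_a₀, ha_M, ha_μ⟩ : ∃ a : ℝ, 0 < a ∧ a < a₀ ∧ a < M ∧ a ≤ M ^ 2 * μ₀ :=
    ⟨min (min (a₀ / 2) (M / 2)) (M ^ 2 * μ₀),
      lt_min (lt_min (half_pos ha₀) (half_pos hM)) (by positivity),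
      ((min_le_left _ _).trans (min_le_left _ _)).trans_lt (half_lt_self ha₀),
      ((min_le_left _ _).trans (min_le_right _ _)).trans_lt (half_lt_self hM),
      min_le_right _ _⟩
  have hsub : Kerr.IsSubextremal M a := by
    show |a| < M
    rwa [abs_of_pos ha_pos]
  obtain ⟨μ, hμ, hμδ, ε, hε, c, hc, ψ, hψ, hsol, hfin, hgrow⟩ :=
    h M a hsub ha_pos.ne' 1 one_ne_zero (μ₀ / 2) (half_pos hμ₀)
  refine ⟨a, ha_pos, ha_a₀, hsub, μ, hμ, ?_, ε, hε, c, hc, ψ, hψ, hsol, hfin, hgrow⟩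
  have hr : M ≤ Kerr.rPlus M a := le_add_of_nonneg_right (Real.sqrt_nonneg _)
  have hr0 : 0 < Kerr.rPlus M a := hM.trans_le hr
  have hden : 0 < 2 * M * Kerr.rPlus M a := by positivity
  have h1 : |a * ((1 : ℤ) : ℝ)| / (2 * M * Kerr.rPlus M a) ≤ μ₀ / 2 := by
    rw [Int.cast_one, mul_one, abs_of_pos ha_pos, div_le_iff₀ hden]
    have h2 : M ^ 2 * μ₀ ≤ M * Kerr.rPlus M a * μ₀ := by
      have := mul_le_mul_of_nonneg_left hr hM.le
      nlinarith
    nlinarith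
  have h3 := (abs_lt.1 hμδ).2
  linarith

/-- **Barrier (superradiant instability of massive fields), NARROWED by the audit of 2026-08-15:
in every neighbourhood of `(a, μ) = (0, 0)` there are a sub-extremal spin `0 < a < a₀` and a mass
`0 < μ < μ₀` for which the Klein–Gordon equation on the Kerr exterior `(M, a)` has a smooth,
finite-energy, exponentially growing solution** — the joint-smallness content of
Shlapentokh-Rothman, CMP 329 (2014), Thm. 1.1 with its mass clause ("For every non-zero integer
`m`, `μ` can be chosen arbitrarily close to `|am|/(2Mr₊)`. In particular, `μ` can be made
arbitrarily small as `a → 0`", p. 3), which is the premise of the printed no-go sentence "as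
`|a| → 0` [...] we have produced exponentially growing and finite energy solutions with
arbitrarily small mass. Thus, any argument used for the wave equation must break down for
Klein–Gordon equations with arbitrarily small mass" (§1.1, p. 4). It follows from the original
fact (`KleinGordonSuperradiantInstabilityNarrow.of`, via `.small_spin_small_mass`); the fixed-`a`
content — masses in every neighbourhood of `|am|/(2Mr₊)`, `m ≠ 0` — remains the original
declaration `KleinGordonSuperradiantInstability`, unchanged.

**Vendored form**: for every `M > 0`, `a₀ > 0`, `μ₀ > 0` there are `a` with `0 < a < a₀`,
`|a| < M`, `μ` with `0 < μ < μ₀`, rates `ε, c > 0` and a globally `C^∞` real `ψ` on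
`Kerr.exterior M a` with `□_{g_{M,a}} ψ = μ² ψ`, `kgSliceEnergy ψ τ μ < ∞` and
`sliceEnergy ψ τ ≥ c e^{ε τ}` for all leaves `{t_KS = τ}`, `τ ≥ 0`.

BARRIER (D-0021; narrowed replacement of the block of `KleinGordonSuperradiantInstability`; every
clause is a quotation or close paraphrase of the cited locus):
* technique_class: kerr-stability, Klein-Gordon, small-angular-momentum-uniform (schemes stated for ALL `|a| < a₀`), mass-uniform / zeroth-order-robust with an `a`-INDEPENDENT mass threshold, boundedness-by-structure; at fixed `a ≠ 0`: all-masses-robust (schemes indifferent to every `μ²ψ`, `μ > 0`) and near-threshold-mass-robust (`μ` near `|am|/(2Mr₊)`), large-short-range-potential-robust — and NOT the unqualified `mass-insensitive`, `lower-order-robust`, `general-linear-fields` of the original block at fixed `a` (gap (G1), evasion (E4)).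
* blocks: (B1) uniformly in small spin: any scheme proving, for some `a₀ > 0` and ALL `0 < |a| < a₀`, uniform boundedness (a fortiori decay) of finite-energy solutions of `□_g ψ = 0` on Kerr `(M, a)` by steps that apply verbatim to `(□_g − μ²)ψ = 0` for all `0 < μ < μ₀` with `μ₀` independent of `a` — `.no_small_parameter_bound`; "as `|a| → 0` (where superradiance is weaker and one expects the problem to get easier) we have produced exponentially growing and finite energy solutions with arbitrarily small mass. Thus, any argument used for the wave equation must break down for Klein–Gordon equations with arbitrarily small mass" [cite: ShlapentokhRothman2014KleinGordon, §1.1 (p. 4)]; in particular the literal fixed-`m` claim "for `μ > 0` sufficiently small and `a` sufficiently small, depending on `m`, the statement of Theorem [5.1] holds for [Klein–Gordon]" [cite: arXiv08110354, §8.3] is incompatible with the mode families of Thm. 1.2 at that `m` [cite: ShlapentokhRothman2014KleinGordon, Thm. 1.2 (p. 5)]; (B2) at fixed `0 < |a| < M`: any boundedness scheme indifferent to a mass term `μ²ψ` with `μ` in a neighbourhood of `|am|/(2Mr₊)` for some `m ∈ ℤ ∖ {0}` — hence any scheme indifferent to ALL masses `μ > 0` — the original `KleinGordonSuperradiantInstability`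 / `.no_uniform_energy_bound` [cite: ShlapentokhRothman2014KleinGordon, Thm. 1.1 (p. 3)]; and unconditional linear stability of Kerr `(M, a)` as a solution of the Einstein–Klein–Gordon system with such a mass [cite: ShlapentokhRothman2014KleinGordon, abstract]; (B3) at fixed `0 < |a| < M`: extending real-mode stability / boundedness to `□_g ψ − Vψ = 0` for ALL smooth stationary axisymmetric `V ≥ 0` of compact spatial support, or to all compact-in-space stationary axisymmetric metric deformations keeping `g(∂_t, ∂_t) < 0` on the deformed region: "the mode stability statement of [Whiting 1989, SR 2015] can not be extended to include the case when an arbitrary term of the form `−Vψ`, with `V ≥ 0` compactly supported in the region `{r ≫ 1}`, is added" [cite: Moschidis2017, §1.1 and Thm. 1] [cite: Moschidis2017, Thm. 2]; the zero-frequency continuity criterion for integrated local energy decay "fails in the case of `(𝓜_{M,a}, g_{M,a})` with `a ≠ 0`" [cite: Moschidis2017, §1.5].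
* because: the growing solutions are "superradiant bound states, i.e. the energy flux will be negative along the horizon, and the solution will spatially decay exponentially fast so that no energy is radiated away to infinity [...] this is what provides the mechanism for the exponential growth" [cite: ShlapentokhRothman2014KleinGordon, §1 (p. 4)]; they come in real-analytic one-parameter families `(ω_R(ε) + iε, m, l, μ(ε))`, `−δ < ε < δ`, with `μ(0) > |ω_R(0)|`, `ω_R(0) = am/(2Mr₊)`, "the modes lose mass as they become unstable `∂μ/∂ε(0) < 0`", all superradiant `|am| − 2Mr₊|ω| > 0` [cite: ShlapentokhRothman2014KleinGordon, Thm. 1.2 (p. 5)], perturbed off real bound-state modes which exist only with `am − 2Mr₊ω = 0`, `am ≠ 0`, `ω² < μ² < ω² + C(m, l)`, `C(m, l) → 0` as `l → ∞` [cite: ShlapentokhRothman2014KleinGordon, Thm. 1.3 (p. 5)] — so at fixed `a` the certified masses cluster at `|am|/(2Mr₊) ≥ |a|/(2Mr₊)`, and become small only as `|a| → 0` (with `r₊ ≥ M`, `|am|/(2Mr₊) ≤ |a||m|/(2M²)`; `.small_spin_small_mass`); the horizon energy density `Re(Tψ · conj(Tψ + (a/2Mr₊)Φψ))` "is clearly possible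 [...] to be negative" for `a ≠ 0` [cite: ShlapentokhRothman2014KleinGordon, §1 (pp. 3–4)] (`KerrSuperradiance.lean`).
* evasions_known: (E1) the massless equation on the full sub-extremal range: boundedness and decay (`Literature.Geometry.Lorentzian.drsr_wave_boundedness_kerr`, `drsr_wave_polynomial_decay_kerr`) through quantitative real-mode stability — precisely what fails for the massive equation via the real modes of Thm. 1.3 — and "superradiant frequencies are not trapped" [cite: DafermosRodnianskiShlapentokhrothman2014, §1.1 and Thm. 3.1] [cite: Whiting1989] [cite: Shlapentokhrothman2014]; (E2) fixed `m`, LARGE masses: "the solutions of the RKG [the Klein–Gordon field reduced by separation in the azimuth angle] are stable for `μ ≥ (|m|a/(2Mr₊)) √(1 + 2M/r₊)`" [cite: Beyer2011, §1 (p. 4)], reported as "no unstable modes can exist if `μ ≥ (|am|/(2Mr₊)) √(1 + 2M/r₊)`" [cite: ShlapentokhRothman2014KleinGordon, §1.4 (p. 5)]; (E3) CLAIMED, not proved in print — fixed `m`, small `a`, mass small RELATIVE TO `a`: "if `a` is small, and `μ` is small relative to `a` and `m`, then the techniques developed by Dafermos and Rodnianski in [Invent. Math. 185 (2011)] can be used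 to show that no unstable modes exist" [cite: ShlapentokhRothman2014KleinGordon, §1.4 (p. 5)] [cite: DafermosRodnianski2011], the weakened form of "if one fixed `m`, then adapting the proof of Section [5.2], one can show that for `μ > 0` sufficiently small and `a` sufficiently small, depending on `m`, the statement of Theorem [5.1] holds for [Klein–Gordon] for such Kerr's. This is consistent with the quasinormal mode picture, as one must take `m → ∞` for the modes to approach the real axis in Schwarzschild" [cite: arXiv08110354, §8.3] — the literal form is refuted by (B1)/(B2), the weakened form contradicts the heuristic rate of (G1); (E4) at fixed `a`, SMALL short-range potentials: "the techniques employed in [SR, AHP 16 (2015)] are robust enough to yield a mode stability statement for small short-range potential perturbations of [`□_g ψ = 0`]" and, for the family `□_g ψ − λVψ = 0`, "when `λ` is close to `0`, the robustness of the method of [SR 2015] implies that [it] does not admit any real mode solutions" [cite: Moschidis2017, §1 (p. 3) and §1.5] [cite: ShlapentokhRothman2015ModeStability]; (E5) positive cosmological constant, fixed azimuthal number: "There exists `a₀ > 0` such that for all `|a| < a₀` and `n ∈ ℤ ∖ {0}`" the wave operators exist and are complete on the angular-momentum-`n` energy space of the Klein–Gordon field `(□_g + m²)u = 0`, mass `m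 ≥ 0`, on De Sitter–Kerr (asymptotic completeness), and the same "for `n = 0` if the mass `m` of the field is strictly positive" [cite: GeorgescuGerardHafner2014, Thm. 1.1].
* scope_caveats: (a) GAP (G1) — fixed `0 < |a| < M`, masses `0 < μ ≪ |a|/M²` (`Mμ ≪ 1`, `μ < mΩ_H`, `Ω_H = a/(2Mr₊)`): no theorem in the sources gives or excludes growing finite-energy solutions there; the heuristic/numerical literature predicts growth for every such mass — e-folding time "`τ ≈ 24 (a/M)⁻¹ (μM)⁻⁹ (GM/c³)`" for the `l = m = 1` state, `Mμ ≪ 1` [cite: Detweiler1980] as quoted in [cite: Dolan2007, §I], "all bound states with `Re(ω) ≲ ω_c` are unstable" [cite: Dolan2007, §IV], "Zouros and Eardley and Detweiler developed more involved heuristics, all leading to the same conclusion" [cite: ShlapentokhRothman2014KleinGordon, §1.5 (p. 6)] [cite: ZourosEardley1979], "it is thought that essentially this sequence 'moves up' and produces exponentially growing solutions" and Open Problem 7 "Construct an exponentially growing solution of [Klein–Gordon] on Kerr, for arbitrarily small `μ > 0` and arbitrary small `a`" [cite: arXiv08110354, §8.3] — settled by Thm. 1.1 only in the coupled sense `μ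 ≈ |a|/(2Mr₊)`; the 2025 survey still records Thm. 1.1 as the result: "the presence of mass or charge of the field can also create growing modes, we refer to Shlapentokh-Rothman for the Klein Gordon equation on the Kerr metric" [cite: Hafner2025, §5.5.3]; consequently a fixed-`a` argument that is sensitive to zeroth-order terms only below the scale `|a|/M²` is NOT touched by any theorem here (nor shown to exist: (E3) is a claim); (b) energy/existence form and leaves as in caveats (b)–(c) of the original block: one real solution, finite coordinate Klein–Gordon energy and an exponential lower bound for the first-order coordinate energy on the prelude's leaves `{t_KS = τ}`, `τ ≥ 0` — mode structure, azimuthal number, pointwise Boyer–Lindquist bounds and openness of the mass family are not vendored, so (B1)–(B2) speak of ALL finite-energy solutions, not of fixed-`m` subspaces (the fixed-`m` reading of (B1) rests on the printed Thm. 1.2, whose modes have azimuthal number `m`); (c) `M > 0`, `0 < a < min(a₀, M)` (positive spin suffices; `a ↦ −a` is the reflection `φ ↦ −φ`); (d) (B3), (E2), (E4), (E5) are quoted, not formalised — no potential `V`, reduced field or De Sitter–Kerr metric exists in the prelude; (e) nothing nonlinear is asserted [cite: ShlapentokhRothman2014KleinGordon, abstract].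
* status: established — follows from `KleinGordonSuperradiantInstability` [cite: ShlapentokhRothman2014KleinGordon, Thm. 1.1] by `KleinGordonSuperradiantInstabilityNarrow.of` (proved here); narrowed from the block of `KleinGordonSuperradiantInstability` by the barrier audit of 2026-08-15 (quantifier order of "arbitrarily small mass"; `evasions_known:` and the fixed-`a` gap brought to the record). -/
def KleinGordonSuperradiantInstabilityNarrow : Prop :=
  ∀ [Kerr.Facts] [Kerr.SliceFacts] (M : ℝ), 0 < M → ∀ a₀ > (0 : ℝ), ∀ μ₀ > (0 : ℝ),
    ∃ a : ℝ, 0 < a ∧ a < a₀ ∧ Kerr.IsSubextremal M a ∧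
    ∃ μ : ℝ, 0 < μ ∧ μ < μ₀ ∧
    ∃ ε > (0 : ℝ), ∃ c > (0 : ℝ), ∃ ψ : Kerr.exterior M a → ℝ,
      ContMDiff 𝓘(ℝ, E4) 𝓘(ℝ, ℝ) ∞ ψ ∧
      (∀ x : Kerr.exterior M a,
        (Kerr.smoothMetric M a (Kerr.rPlus M a)).toPseudoRiemannianMetric.dalembertian ψ x =
          μ ^ 2 * ψ x) ∧
      (∀ τ : ℝ, 0 ≤ τ → kgSliceEnergy (Kerr.exterior M a) ψ τ μ < ⊤) ∧
      ∀ τ : ℝ, 0 ≤ τ →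
        ENNReal.ofReal (c * Real.exp (ε * τ)) ≤ sliceEnergy (Kerr.exterior M a) ψ τ

/-- The narrowed declaration follows from the original fact (Thm. 1.1 with the mass clause at
`m = 1`): `KleinGordonSuperradiantInstability.small_spin_small_mass`. Shlapentokh-Rothman,
CMP 329 (2014), Thm. 1.1 (p. 3). [cite: ShlapentokhRothman2014KleinGordon, Thm. 1.1 (p. 3)] -/
theorem KleinGordonSuperradiantInstabilityNarrow.of (h : KleinGordonSuperradiantInstability) :
    KleinGordonSuperradiantInstabilityNarrow := by
  intro _ _ M hM a₀ ha₀ μ₀ hμ₀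
  exact h.small_spin_small_mass hM ha₀ hμ₀

/-- **No small-parameter Klein–Gordon boundedness theorem (the certified no-go, quantifiers
explicit).** Under the narrowed fact, for `M > 0` there are NO thresholds `a₀, μ₀ > 0` such that
for every sub-extremal spin `0 < a < a₀` and every mass `0 < μ < μ₀`, every globally `C^∞`
solution of `□_{g_{M,a}} ψ = μ² ψ` on `Kerr.exterior M a` with finite Klein–Gordon energy on the
leaves `τ ≥ 0` obeys `E_KG(τ) ≤ C · E_KG(0)`, `τ ≥ 0`, for some `C < ∞` (allowed to depend on
`a`, `μ` and even on `ψ`). This is the precise sense of "any argument used for the wave equation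
must break down for Klein–Gordon equations with arbitrarily small mass": an argument for slowly
rotating Kerr, `|a| < a₀`, that is robust under masses below an `a`-independent threshold.
Shlapentokh-Rothman, CMP 329 (2014), §1.1 (p. 4); contrast Dafermos–Rodnianski,
arXiv:0811.0354, §8.3. [cite: ShlapentokhRothman2014KleinGordon, §1.1 (p. 4)] -/
theorem KleinGordonSuperradiantInstabilityNarrow.no_small_parameter_bound
    (h : KleinGordonSuperradiantInstabilityNarrow) [Kerr.Facts] [Kerr.SliceFacts] {M : ℝ}
    (hM : 0 < M) :
    ¬ ∃ a₀ > (0 : ℝ), ∃ μ₀ > (0 : ℝ), ∀ a : ℝ, 0 < a → a < a₀ → Kerr.IsSubextremal M a →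
        ∀ μ : ℝ, 0 < μ → μ < μ₀ → ∀ ψ : Kerr.exterior M a → ℝ,
          ContMDiff 𝓘(ℝ, E4) 𝓘(ℝ, ℝ) ∞ ψ →
          (∀ x : Kerr.exterior M a,
            (Kerr.smoothMetric M a (Kerr.rPlus M a)).toPseudoRiemannianMetric.dalembertian ψ x =
              μ ^ 2 * ψ x) →
          (∀ τ : ℝ, 0 ≤ τ → kgSliceEnergy (Kerr.exterior M a) ψ τ μ < ⊤) →
          ∃ C : ℝ≥0∞, C ≠ ⊤ ∧ ∀ τ : ℝ, 0 ≤ τ →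
            kgSliceEnergy (Kerr.exterior M a) ψ τ μ ≤ C * kgSliceEnergy (Kerr.exterior M a) ψ 0 μ := by
  rintro ⟨a₀, ha₀, μ₀, hμ₀, H⟩
  obtain ⟨a, ha, haa₀, hsub, μ, hμ, hμμ₀, ε, hε, c, hc, ψ, hψ, hsol, hfin, hgrow⟩ :=
    h M hM a₀ ha₀ μ₀ hμ₀
  obtain ⟨C, hC, hbound⟩ := H a ha haa₀ hsub μ hμ hμμ₀ ψ hψ hsol hfin
  obtain ⟨τ, hτ, hlt⟩ := kgSliceEnergy_ratio_unbounded_of_growth hε hc hfin hgrow C hC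
  exact lt_irrefl _ (hlt.trans_le (hbound τ hτ))

/-- The same no-go read directly off the original fact. Shlapentokh-Rothman, CMP 329 (2014),
Thm. 1.1 and §1.1 (p. 4). [cite: ShlapentokhRothman2014KleinGordon, Thm. 1.1 and §1.1 (p. 4)] -/
theorem KleinGordonSuperradiantInstability.no_small_parameter_bound
    (h : KleinGordonSuperradiantInstability) [Kerr.Facts] [Kerr.SliceFacts] {M : ℝ}
    (hM : 0 < M) :
    ¬ ∃ a₀ > (0 : ℝ), ∃ μ₀ > (0 : ℝ), ∀ a : ℝ, 0 < a → a < a₀ → Kerr.IsSubextremal M a →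
        ∀ μ : ℝ, 0 < μ → μ < μ₀ → ∀ ψ : Kerr.exterior M a → ℝ,
          ContMDiff 𝓘(ℝ, E4) 𝓘(ℝ, ℝ) ∞ ψ →
          (∀ x : Kerr.exterior M a,
            (Kerr.smoothMetric M a (Kerr.rPlus M a)).toPseudoRiemannianMetric.dalembertian ψ x =
              μ ^ 2 * ψ x) →
          (∀ τ : ℝ, 0 ≤ τ → kgSliceEnergy (Kerr.exterior M a) ψ τ μ < ⊤) →
          ∃ C : ℝ≥0∞, C ≠ ⊤ ∧ ∀ τ : ℝ, 0 ≤ τ →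
            kgSliceEnergy (Kerr.exterior M a) ψ τ μ ≤ C * kgSliceEnergy (Kerr.exterior M a) ψ 0 μ :=
  KleinGordonSuperradiantInstabilityNarrow.no_small_parameter_bound
    (KleinGordonSuperradiantInstabilityNarrow.of h) hM


end Literature.Barriers.FinalStateConjecture

end
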